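import Mathlib.Analysis.Complex.CauchyIntegral
import Mathlib.Analysis.SpecialFunctions.Integrals.Basic
import Mathlib.Analysis.SpecialFunctions.ImproperIntegrals
import Mathlib.Analysis.SpecialFunctions.Pow.Asymptotics
import Mathlib.MeasureTheory.Integral.IntegralEqImproper
import Mathlib.Analysis.Analytic.IsolatedZeros
import HarnessLib

/-!
# Cauchy's theorem and Cauchy's formula for the upper half-plane, along the real axis

The analytic engine behind the reproducing-kernel identity of de Branges spaces
(Conrey–Li 2000, §2, (2.2): "obtained by using Cauchy's integration formula in the upper
half-plane"). For a function `g` holomorphic on a neighbourhood of the closed upper half-plane,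
square integrable on `ℝ` and `O(1/√(Im z))` far out in the open upper half-plane, we prove

* `integral_div_sub_eq_zero_of_im_neg`: `∫_ℝ g(x)/(x − a) dx = 0` when `Im a < 0`;
* `integral_div_sub_eq_of_im_pos`: `∫_ℝ g(x)/(x − w) dx = 2πi g(w)` when `Im w > 0`.

Both come from one contour lemma, `integral_eq_zero_of_decay` — Cauchy–Goursat on the squares
`[−R, R] × [0, R]` (Mathlib's `Complex.integral_boundary_rect_eq_zero_of_differentiableOn`) for an
integrand `h` with `‖h z‖ ≤ C/(√(Im z) ‖z‖)` far out, whose three far sides are `O(R^{-1/2})` —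
applied to `g(z)/(z − a)`, resp. to `(g(z) − g(w) φ(z))/(z − w)` with the decaying interpolant
`φ(z) = (w − w̄)/(z − w̄)`, `φ(w) = 1`, `∫_ℝ φ(x)/(x − w) dx = 2πi`.

The growth hypothesis `O(1/√(Im z))` (only for `‖z‖` large) is the one available for quotients
`F/E`, `F ∈ 𝓗(E)`, from the pointwise bound `|F(z)|² ≤ ‖F‖² K(z, z) ≤ ‖F‖² |E(z)|²/(4π Im z)`.

## References

* J. B. Conrey, X.-J. Li, IMRN 2000:18 = arXiv:math/9812166, §2 [ConreyLi2000].
* L. de Branges, *Hilbert spaces of entire functions* (1968), Thms 19–20. All statements here are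
  classical (folklore).
-/

noncomputable section

open scoped Real Topology ComplexConjugate Interval
open _root_.Complex _root_.MeasureTheory _root_.Filter _root_.Set intervalIntegral

namespace Literature.Analysis.DeBrangesSpaces

/-! ### Elementary integrals and integrability on the real line -/

/-- `x ↦ ((x − a)² + b²)⁻¹` is integrable on `ℝ` for `b ≠ 0`. [folklore] -/
theorem integrable_inv_sub_sq_add_sq (a : ℝ) {b : ℝ} (hb : b ≠ 0) :
    Integrable fun x : ℝ ↦ ((x - a) ^ 2 + b ^ 2)⁻¹ := by
  have h : Integrable fun k : ℝ ↦ (b ^ 2)⁻¹ * (1 + (b⁻¹ * k) ^ 2)⁻¹ :=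
    (integrable_inv_one_add_sq.comp_mul_left' (inv_ne_zero hb)).const_mul _
  have h' : Integrable fun k : ℝ ↦ (k ^ 2 + b ^ 2)⁻¹ := by
    refine h.congr (ae_of_all _ fun k ↦ ?_)
    field_simp
    ring
  exact h'.comp_sub_right a

/-- `∫_ℝ dx/((x − a)² + b²) = π/b` for `b > 0`. [folklore] -/
theorem integral_inv_sub_sq_add_sq (a : ℝ) {b : ℝ} (hb : 0 < b) :
    ∫ x : ℝ, ((x - a) ^ 2 + b ^ 2)⁻¹ = π / b := by
  have h1 : ∫ x : ℝ, ((x - a) ^ 2 + b ^ 2)⁻¹ = ∫ k : ℝ, (k ^ 2 + b ^ 2)⁻¹ :=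
    integral_sub_right_eq_self (fun k ↦ (k ^ 2 + b ^ 2)⁻¹) a
  have h2 : (fun k : ℝ ↦ (k ^ 2 + b ^ 2)⁻¹) = fun k ↦ (b ^ 2)⁻¹ * (1 + (b⁻¹ * k) ^ 2)⁻¹ := by
    funext k
    have hb2 : b ≠ 0 := hb.ne'
    field_simp
    ring
  rw [h1, h2, MeasureTheory.integral_const_mul,
    Measure.integral_comp_inv_mul_left (fun t : ℝ ↦ (1 + t ^ 2)⁻¹) b,
    integral_univ_inv_one_add_sq, abs_of_pos hb, smul_eq_mul]
  have hb2 : b ≠ 0 := hb.ne'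
  field_simp

/-- `‖x − w‖² = (x − Re w)² + (Im w)²` for real `x`. [folklore] -/
theorem norm_ofReal_sub_sq (x : ℝ) (w : ℂ) : ‖(x : ℂ) - w‖ ^ 2 = (x - w.re) ^ 2 + w.im ^ 2 := by
  rw [← Complex.normSq_eq_norm_sq, Complex.normSq_apply]
  simp
  ring

/-- `|Im w| ≤ ‖x − w‖` for real `x`. [folklore] -/
theorem abs_im_le_norm_ofReal_sub (x : ℝ) (w : ℂ) : |w.im| ≤ ‖(x : ℂ) - w‖ := by
  have h := Complex.abs_im_le_norm ((x : ℂ) - w)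
  simpa using h

/-- `(x − w̄)(x − w) = (x − Re w)² + (Im w)²` for real `x`. [folklore] -/
theorem ofReal_sub_conj_mul_ofReal_sub (x : ℝ) (w : ℂ) :
    ((x : ℂ) - conj w) * ((x : ℂ) - w) = (((x - w.re) ^ 2 + w.im ^ 2 : ℝ) : ℂ) := by
  apply Complex.ext
  · simp only [mul_re, sub_re, ofReal_re, conj_re, sub_im, ofReal_im, conj_im, zero_sub,
      neg_neg]
    ring
  · simp only [mul_im, sub_re, ofReal_re, conj_re, sub_im, ofReal_im, conj_im, zero_sub,
      neg_neg]
    ring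

/-- `x ↦ ‖(x − w)⁻¹‖²` is integrable on `ℝ` for non-real `w`. [folklore] -/
theorem integrable_norm_inv_ofReal_sub_sq {w : ℂ} (hw : w.im ≠ 0) :
    Integrable fun x : ℝ ↦ ‖((x : ℂ) - w)⁻¹‖ ^ 2 := by
  refine (integrable_inv_sub_sq_add_sq w.re hw).congr (ae_of_all _ fun x ↦ ?_)
  simp only [norm_inv, inv_pow, norm_ofReal_sub_sq]

/-- An `L² × L²` product on the real line is integrable: if `‖u‖²` is integrable and `w` is
non-real then `x ↦ u(x)/(x − w)` is integrable. [folklore] -/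
theorem integrable_div_ofReal_sub {u : ℝ → ℂ} (hu : AEStronglyMeasurable u volume)
    (hu2 : Integrable fun x : ℝ ↦ ‖u x‖ ^ 2) {w : ℂ} (hw : w.im ≠ 0) :
    Integrable fun x : ℝ ↦ u x / ((x : ℂ) - w) := by
  have hne : ∀ x : ℝ, (x : ℂ) - w ≠ 0 := fun x h ↦ hw (by
    have := congrArg Complex.im h
    simpa using this)
  have hcont : Continuous fun x : ℝ ↦ ((x : ℂ) - w)⁻¹ :=
    (Complex.continuous_ofReal.sub continuous_const).inv₀ hne
  have heq : (fun x : ℝ ↦ u x / ((x : ℂ) - w)) = fun x ↦ u x * ((x : ℂ) - w)⁻¹ := by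
    funext x; rw [div_eq_mul_inv]
  rw [heq]
  refine Integrable.mono' ((hu2.add (integrable_norm_inv_ofReal_sub_sq hw)).div_const 2)
    (hu.mul hcont.aestronglyMeasurable) (ae_of_all _ fun x ↦ ?_)
  simp only [Pi.add_apply]
  rw [norm_mul]
  nlinarith [sq_nonneg (‖u x‖ - ‖((x : ℂ) - w)⁻¹‖), norm_nonneg (u x), norm_nonneg ((x : ℂ) - w)⁻¹]

/-- The interpolant tested against the Cauchy kernel is a real multiple of `2 Im w · i`:
`(w − w̄)/((x − w̄)(x − w)) = 2i Im w · ((x − Re w)² + (Im w)²)⁻¹` for real `x`. [folklore] -/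
theorem interpolant_apply (w : ℂ) (x : ℝ) :
    (w - conj w) / ((((x : ℂ) - conj w)) * ((x : ℂ) - w)) =
      (2 * w.im * I) * ((((x - w.re) ^ 2 + w.im ^ 2)⁻¹ : ℝ) : ℂ) := by
  have hwc : w - conj w = 2 * w.im * I := by
    rw [Complex.sub_conj]; push_cast; ring
  rw [ofReal_sub_conj_mul_ofReal_sub, hwc, div_eq_mul_inv]
  push_cast
  ring

/-- The interpolant tested against the Cauchy kernel is integrable on `ℝ` (`w` non-real).
[folklore] -/
theorem integrable_interpolant {w : ℂ} (hw : w.im ≠ 0) :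
    Integrable fun x : ℝ ↦ (w - conj w) / ((((x : ℂ) - conj w)) * ((x : ℂ) - w)) := by
  simp_rw [interpolant_apply]
  exact (integrable_inv_sub_sq_add_sq w.re hw).ofReal.const_mul _

/-- `∫_ℝ (w − w̄)/((x − w̄)(x − w)) dx = 2πi` for `Im w > 0` (the interpolant `φ(z) = (w − w̄)/(z − w̄)`
tested against the Cauchy kernel). [folklore] -/
theorem integral_interpolant {w : ℂ} (hw : 0 < w.im) :
    ∫ x : ℝ, (w - conj w) / ((((x : ℂ) - conj w)) * ((x : ℂ) - w)) = 2 * π * I := by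
  simp_rw [interpolant_apply]
  rw [MeasureTheory.integral_const_mul, integral_complex_ofReal, integral_inv_sub_sq_add_sq w.re hw]
  have hw' : (w.im : ℂ) ≠ 0 := by exact_mod_cast hw.ne'
  push_cast
  rw [div_eq_mul_inv, show (2 * (w.im : ℂ) * I) * (↑π * (↑w.im)⁻¹) = 2 * ↑π * I * (↑w.im * (↑w.im)⁻¹)
    by ring, mul_inv_cancel₀ hw', mul_one]

/-! ### The contour lemma -/

/-- For `0 < Im z`, `1 ≤ ‖z‖`: `1/‖z‖² ≤ 1/(√(Im z) ‖z‖)`. [folklore] -/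
theorem inv_norm_sq_le_inv_sqrt_im_mul_norm {z : ℂ} (hz : 0 < z.im) (h1 : 1 ≤ ‖z‖) :
    1 / ‖z‖ ^ 2 ≤ 1 / (√z.im * ‖z‖) := by
  have him : z.im ≤ ‖z‖ := (le_abs_self _).trans (Complex.abs_im_le_norm z)
  have hsqrt : √z.im ≤ ‖z‖ := by
    calc √z.im ≤ √‖z‖ := Real.sqrt_le_sqrt him
      _ ≤ ‖z‖ := by
          rw [Real.sqrt_le_left (by linarith)]
          nlinarith
  have hpos : 0 < √z.im := Real.sqrt_pos.2 hz
  refine one_div_le_one_div_of_le (by positivity) ?_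
  rw [sq]
  exact mul_le_mul_of_nonneg_right hsqrt (by linarith)

/-- **Contour lemma.** If `h` is complex differentiable at every point of the closed upper
half-plane, integrable on `ℝ`, and `‖h z‖ ≤ C/(√(Im z) ‖z‖)` for `Im z > 0`, `‖z‖ ≥ R₀`, then
`∫_ℝ h = 0`: Cauchy–Goursat on `[−R, R] × [0, R]`, where the three sides off the real axis are
`O(R^{-1/2})`. [folklore] -/
theorem integral_eq_zero_of_decay {h : ℂ → ℂ} {C R₀ : ℝ} (hC : 0 ≤ C)
    (hd : ∀ z : ℂ, 0 ≤ z.im → DifferentiableAt ℂ h z)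
    (hi : Integrable fun x : ℝ ↦ h x)
    (hb : ∀ z : ℂ, 0 < z.im → R₀ ≤ ‖z‖ → ‖h z‖ ≤ C / (√z.im * ‖z‖)) :
    ∫ x : ℝ, h x = 0 := by
  have hlim1 : Tendsto (fun R : ℝ ↦ ∫ x in -R..R, h x) atTop (𝓝 (∫ x : ℝ, h x)) :=
    intervalIntegral_tendsto_integral hi tendsto_neg_atTop_atBot tendsto_id
  have hlim2 : Tendsto (fun R : ℝ ↦ ∫ x in -R..R, h x) atTop (𝓝 0) := by
    have hrate : Tendsto (fun R : ℝ ↦ 6 * C * R ^ (-(1 / 2 : ℝ))) atTop (𝓝 0) := by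
      have := (tendsto_rpow_neg_atTop (by norm_num : (0 : ℝ) < 1 / 2)).const_mul (6 * C)
      simpa using this
    refine squeeze_zero_norm' ?_ hrate
    filter_upwards [eventually_ge_atTop R₀, eventually_ge_atTop (1 : ℝ)] with R hR hR1
    have hRpos : 0 < R := by linarith
    have hsqrtR : √R = R ^ (1 / 2 : ℝ) := Real.sqrt_eq_rpow R
    have hRhalf : R ^ (1 / 2 : ℝ) / R = R ^ (-(1 / 2 : ℝ)) := by
      rw [show (-(1 / 2 : ℝ)) = 1 / 2 - 1 by norm_num, Real.rpow_sub_one hRpos.ne']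
    have hR12 : 0 < R ^ (1 / 2 : ℝ) := Real.rpow_pos_of_pos hRpos _
    -- Cauchy–Goursat on the square `[-R, R] × [0, R]`
    have hrect := Complex.integral_boundary_rect_eq_zero_of_differentiableOn h (-(R : ℂ))
      (R + R * I) (by
        intro z hz
        refine (hd z ?_).differentiableWithinAt
        have hz2 := hz.2
        simp only [neg_im, ofReal_im, neg_zero, add_im, ofReal_re, mul_im, I_re, mul_zero, I_im,
          mul_one, zero_add, ofReal_im] at hz2
        rcases Set.mem_uIcc.1 hz2 with h' | h' <;> linarith [h'.1, h'.2])
    simp only [ofReal_re, ofReal_im, add_re, mul_re, I_re, mul_zero, I_im, mul_one, sub_self,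
      add_zero, add_im, mul_im, zero_add, ofReal_zero, zero_mul, neg_re, neg_im, neg_zero,
      ofReal_neg] at hrect
    -- the top side
    have htop : ‖∫ x in -R..R, h (x + R * I)‖ ≤ 2 * C * R ^ (-(1 / 2 : ℝ)) := by
      have hb' : ∀ x ∈ Ι (-R) R, ‖h (x + R * I)‖ ≤ C / (√R * R) := by
        intro x _
        have him : (x + R * I : ℂ).im = R := by simp
        have hnorm : R ≤ ‖(x + R * I : ℂ)‖ := by
          have := Complex.abs_im_le_norm (x + R * I : ℂ)
          rwa [him, abs_of_pos hRpos] at this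
        have h1 := hb (x + R * I) (by rw [him]; exact hRpos) (hR.trans hnorm)
        rw [him] at h1
        refine h1.trans ?_
        gcongr
      refine (norm_integral_le_of_norm_le_const hb').trans (le_of_eq ?_)
      rw [show |R - -R| = 2 * R by rw [sub_neg_eq_add, abs_of_pos (by linarith)]; ring, hsqrtR,
        Real.rpow_neg hRpos.le]
      field_simp
    -- the vertical sides
    have hside : ∀ s : ℝ, (s = R ∨ s = -R) →
        ‖∫ y in (0 : ℝ)..R, h (s + y * I)‖ ≤ 2 * C * R ^ (-(1 / 2 : ℝ)) := by
      intro s hs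
      have hsabs : |s| = R := by
        rcases hs with rfl | rfl
        · exact abs_of_pos hRpos
        · rw [abs_neg, abs_of_pos hRpos]
      have hbound : ∀ᵐ y : ℝ, y ∈ Set.Ioc (0 : ℝ) R →
          ‖h (s + y * I)‖ ≤ C / R * y ^ (-(1 / 2 : ℝ)) := by
        refine ae_of_all _ fun y hy ↦ ?_
        have him : (s + y * I : ℂ).im = y := by simp
        have hre : (s + y * I : ℂ).re = s := by simp
        have hnorm : R ≤ ‖(s + y * I : ℂ)‖ := by
          have := Complex.abs_re_le_norm (s + y * I : ℂ)
          rwa [hre, hsabs] at this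
        have h1 := hb (s + y * I) (by rw [him]; exact hy.1) (hR.trans hnorm)
        rw [him] at h1
        have hypos : 0 < √y := Real.sqrt_pos.2 hy.1
        calc ‖h (s + y * I)‖ ≤ C / (√y * ‖(s + y * I : ℂ)‖) := h1
          _ ≤ C / (√y * R) := by gcongr
          _ = C / R * y ^ (-(1 / 2 : ℝ)) := by
              rw [Real.sqrt_eq_rpow, Real.rpow_neg hy.1.le]
              field_simp
      have hint : IntervalIntegrable (fun y : ℝ ↦ C / R * y ^ (-(1 / 2 : ℝ))) volume 0 R :=
        (intervalIntegral.intervalIntegrable_rpow' (by norm_num)).const_mul _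
      refine (norm_integral_le_of_norm_le hRpos.le hbound hint).trans (le_of_eq ?_)
      rw [intervalIntegral.integral_const_mul, integral_rpow (Or.inl (by norm_num)),
        show (-(1 / 2 : ℝ) + 1) = 1 / 2 by norm_num, Real.zero_rpow (by norm_num), ← hRhalf]
      field_simp
      ring
    have heq : (∫ x in -R..R, h x) = (∫ x in -R..R, h (x + R * I))
        - I • (∫ y in (0 : ℝ)..R, h (R + y * I)) + I • (∫ y in (0 : ℝ)..R, h (-R + y * I)) := by
      linear_combination hrect
    rw [heq]
    calc ‖(∫ x in -R..R, h (x + R * I)) - I • (∫ y in (0 : ℝ)..R, h (R + y * I))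
            + I • (∫ y in (0 : ℝ)..R, h (-R + y * I))‖
        = ‖(∫ x in -R..R, h (x + R * I)) + -(I • (∫ y in (0 : ℝ)..R, h (R + y * I)))
            + I • (∫ y in (0 : ℝ)..R, h (-R + y * I))‖ := by rw [sub_eq_add_neg]
      _ ≤ ‖∫ x in -R..R, h (x + R * I)‖ + ‖-(I • (∫ y in (0 : ℝ)..R, h (R + y * I)))‖
            + ‖I • (∫ y in (0 : ℝ)..R, h (-R + y * I))‖ := norm_add₃_le
      _ = ‖∫ x in -R..R, h (x + R * I)‖ + ‖I • (∫ y in (0 : ℝ)..R, h (R + y * I))‖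
            + ‖I • (∫ y in (0 : ℝ)..R, h (-R + y * I))‖ := by rw [norm_neg]
      _ ≤ 2 * C * R ^ (-(1 / 2 : ℝ)) + 2 * C * R ^ (-(1 / 2 : ℝ)) + 2 * C * R ^ (-(1 / 2 : ℝ)) := by
          rw [norm_smul, norm_smul, norm_I, one_mul, one_mul]
          have h₁ := hside R (Or.inl rfl)
          have h₂ := hside (-R) (Or.inr rfl)
          push_cast at h₁ h₂
          exact add_le_add_three htop h₁ h₂
      _ = 6 * C * R ^ (-(1 / 2 : ℝ)) := by ring
  exact tendsto_nhds_unique hlim1 hlim2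

/-! ### Cauchy's theorem and Cauchy's formula along the real axis -/

/-- A function complex differentiable at every point of the closed upper half-plane restricts
to a continuous, hence measurable, function on `ℝ`. [folklore] -/
theorem aestronglyMeasurable_ofReal_of_differentiableAt {g : ℂ → ℂ}
    (hd : ∀ z : ℂ, 0 ≤ z.im → DifferentiableAt ℂ g z) :
    AEStronglyMeasurable (fun x : ℝ ↦ g x) volume := by
  have : Continuous fun x : ℝ ↦ g x :=
    continuous_iff_continuousAt.2 fun x ↦
      ((hd x (by simp)).continuousAt).comp Complex.continuous_ofReal.continuousAt
  exact this.aestronglyMeasurable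

/-- **Cauchy's theorem for the upper half-plane, along `ℝ`.** If `g` is complex differentiable
at every point of the closed upper half-plane, `‖g‖²` is integrable on `ℝ`, and
`‖g z‖ ≤ C/√(Im z)` for `Im z > 0`, `‖z‖ ≥ R₀`, then `∫_ℝ g(x)/(x − a) dx = 0` for every `a` in
the open lower half-plane. [folklore] -/
theorem integral_div_sub_eq_zero_of_im_neg {g : ℂ → ℂ} {C R₀ : ℝ} (hC : 0 ≤ C)
    (hd : ∀ z : ℂ, 0 ≤ z.im → DifferentiableAt ℂ g z)
    (hi : Integrable fun x : ℝ ↦ ‖g x‖ ^ 2)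
    (hb : ∀ z : ℂ, 0 < z.im → R₀ ≤ ‖z‖ → ‖g z‖ ≤ C / √z.im)
    {a : ℂ} (ha : a.im < 0) :
    ∫ x : ℝ, g x / (x - a) = 0 := by
  refine integral_eq_zero_of_decay (h := fun z ↦ g z / (z - a)) (C := 2 * C)
    (R₀ := max R₀ (2 * ‖a‖)) (by positivity) ?_ ?_ ?_
  · intro z hz
    have hza : z - a ≠ 0 := by
      intro h
      have := congrArg Complex.im h
      simp only [sub_im, zero_im] at this
      linarith
    exact (hd z hz).div (differentiableAt_id.sub_const a) hza
  · exact integrable_div_ofReal_sub (aestronglyMeasurable_ofReal_of_differentiableAt hd) hi ha.ne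
  · intro z hz hR
    have hR₀ : R₀ ≤ ‖z‖ := (le_max_left _ _).trans hR
    have h2a : 2 * ‖a‖ ≤ ‖z‖ := (le_max_right _ _).trans hR
    have hzpos : 0 < ‖z‖ := norm_pos_iff.2 (by rintro rfl; simp at hz)
    have hza : ‖z‖ / 2 ≤ ‖z - a‖ := by
      have := norm_sub_norm_le z a
      linarith
    have hypos : 0 < √z.im := Real.sqrt_pos.2 hz
    change ‖g z / (z - a)‖ ≤ _
    rw [norm_div]
    calc ‖g z‖ / ‖z - a‖ ≤ (C / √z.im) / (‖z‖ / 2) :=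
          div_le_div₀ (by positivity) (hb z hz hR₀) (by positivity) hza
      _ = 2 * C / (√z.im * ‖z‖) := by
          field_simp

/-- **Cauchy's formula for the upper half-plane, along `ℝ`.** If `g` is complex differentiable
at every point of the closed upper half-plane, `‖g‖²` is integrable on `ℝ`, and
`‖g z‖ ≤ C/√(Im z)` for `Im z > 0`, `‖z‖ ≥ R₀`, then `∫_ℝ g(x)/(x − w) dx = 2πi g(w)` for every
`w` in the open upper half-plane. (Contour lemma applied to `(g − g(w)φ)/(· − w)`,
`φ(z) = (w − w̄)/(z − w̄)`.) [folklore] -/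
theorem integral_div_sub_eq_of_im_pos {g : ℂ → ℂ} {C R₀ : ℝ} (hC : 0 ≤ C)
    (hd : ∀ z : ℂ, 0 ≤ z.im → DifferentiableAt ℂ g z)
    (hi : Integrable fun x : ℝ ↦ ‖g x‖ ^ 2)
    (hb : ∀ z : ℂ, 0 < z.im → R₀ ≤ ‖z‖ → ‖g z‖ ≤ C / √z.im)
    {w : ℂ} (hw : 0 < w.im) :
    ∫ x : ℝ, g x / (x - w) = 2 * π * I * g w := by
  -- the interpolant `φ` and `g₁ = g - g w • φ`, which vanishes at `w`
  set φ : ℂ → ℂ := fun z ↦ (w - conj w) / (z - conj w) with hφ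
  set g₁ : ℂ → ℂ := fun z ↦ g z - g w * φ z with hg₁
  have hne : ∀ z : ℂ, 0 ≤ z.im → z - conj w ≠ 0 := by
    intro z hz h
    have := congrArg Complex.im h
    simp only [sub_im, conj_im, zero_im] at this
    linarith
  have hwcw : w - conj w ≠ 0 := by
    rw [Complex.sub_conj]
    intro h
    have := congrArg Complex.im h
    simp at this
    exact hw.ne' this
  have hnorm_wcw : ‖w - conj w‖ = 2 * w.im := by
    rw [Complex.sub_conj, norm_mul, norm_I, mul_one]
    push_cast
    rw [norm_mul, Complex.norm_ofNat, Complex.norm_real, Real.norm_of_nonneg hw.le]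
  have hφd : ∀ z : ℂ, 0 ≤ z.im → DifferentiableAt ℂ φ z := fun z hz ↦
    (differentiableAt_const _).div (differentiableAt_id.sub_const _) (hne z hz)
  have hg₁d : ∀ z : ℂ, 0 ≤ z.im → DifferentiableAt ℂ g₁ z := fun z hz ↦
    (hd z hz).sub ((differentiableAt_const _).mul (hφd z hz))
  have hφw : φ w = 1 := div_self hwcw
  have hg₁w : g₁ w = 0 := by
    simp only [hg₁, hφw, mul_one, sub_self]
  -- values of `dslope g₁ w` off `w`
  have hds : ∀ z : ℂ, z ≠ w → dslope g₁ w z = g₁ z / (z - w) := by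
    intro z hz
    rw [dslope_of_ne _ hz, slope_def_field, hg₁w, sub_zero]
  have hreal : ∀ x : ℝ, dslope g₁ w x =
      g x / (x - w) - g w * ((w - conj w) / ((((x : ℂ) - conj w)) * ((x : ℂ) - w))) := by
    intro x
    have hxw : (x : ℂ) ≠ w := by
      intro h
      have := congrArg Complex.im h
      simp only [ofReal_im] at this
      linarith
    rw [hds x hxw]
    simp only [hg₁, hφ]
    rw [sub_div, mul_div_assoc, div_div]
  -- integrability on `ℝ` of the two pieces
  have hA : Integrable fun x : ℝ ↦ g x / (x - w) :=
    integrable_div_ofReal_sub (aestronglyMeasurable_ofReal_of_differentiableAt hd) hi hw.ne'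
  have hB : Integrable fun x : ℝ ↦
      g w * ((w - conj w) / ((((x : ℂ) - conj w)) * ((x : ℂ) - w))) :=
    (integrable_interpolant hw.ne').const_mul _
  -- the contour lemma for `dslope g₁ w`
  have key := integral_eq_zero_of_decay (h := dslope g₁ w) (C := 2 * C + 8 * ‖g w‖ * w.im)
    (R₀ := max (max R₀ 1) (2 * ‖w‖)) (by positivity) ?_ ?_ ?_
  · rw [show (fun x : ℝ ↦ dslope g₁ w x) = fun x : ℝ ↦
        g x / (x - w) - g w * ((w - conj w) / ((((x : ℂ) - conj w)) * ((x : ℂ) - w))) from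
      funext hreal, integral_sub hA hB, MeasureTheory.integral_const_mul,
      integral_interpolant hw] at key
    linear_combination key
  · -- differentiability on the closed upper half-plane
    intro z hz
    by_cases hzw : z = w
    · subst hzw
      have hopen : IsOpen {u : ℂ | 0 < u.im} := isOpen_lt continuous_const Complex.continuous_im
      have han : AnalyticAt ℂ g₁ z := by
        refine DifferentiableOn.analyticAt (s := {u : ℂ | 0 < u.im}) ?_ (hopen.mem_nhds hw)
        exact fun u hu ↦ (hg₁d u (le_of_lt hu)).differentiableWithinAt
      obtain ⟨p, hp⟩ := han
      exact hp.has_fpower_series_dslope_fslope.analyticAt.differentiableAt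
    · exact (differentiableAt_dslope_of_ne hzw).2 (hg₁d z hz)
  · -- integrability on `ℝ`
    rw [show (fun x : ℝ ↦ dslope g₁ w x) = fun x : ℝ ↦
        g x / (x - w) - g w * ((w - conj w) / ((((x : ℂ) - conj w)) * ((x : ℂ) - w))) from
      funext hreal]
    exact hA.sub hB
  · -- the decay bound far out
    intro z hz hR
    have hR₀ : R₀ ≤ ‖z‖ := ((le_max_left _ _).trans (le_max_left _ _)).trans hR
    have h1 : 1 ≤ ‖z‖ := ((le_max_right _ _).trans (le_max_left _ _)).trans hR
    have h2w : 2 * ‖w‖ ≤ ‖z‖ := (le_max_right _ _).trans hR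
    have hwpos : 0 < ‖w‖ := norm_pos_iff.2 (by rintro rfl; simp at hw)
    have hzw : z ≠ w := by
      rintro rfl
      linarith
    have hzpos : 0 < ‖z‖ := by linarith
    have hypos : 0 < √z.im := Real.sqrt_pos.2 hz
    have hzw' : ‖z‖ / 2 ≤ ‖z - w‖ := by
      have := norm_sub_norm_le z w
      linarith
    have hzcw : ‖z‖ / 2 ≤ ‖z - conj w‖ := by
      have := norm_sub_norm_le z (conj w)
      rw [Complex.norm_conj] at this
      linarith
    have hgz : ‖g z‖ ≤ C / √z.im := hb z hz hR₀
    have hφz : ‖φ z‖ ≤ 4 * w.im / ‖z‖ := by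
      simp only [hφ]
      rw [norm_div, hnorm_wcw]
      calc 2 * w.im / ‖z - conj w‖ ≤ 2 * w.im / (‖z‖ / 2) :=
            div_le_div_of_nonneg_left (by positivity) (by positivity) hzcw
        _ = 4 * w.im / ‖z‖ := by
            field_simp
            ring
    have hg₁z : ‖g₁ z‖ ≤ C / √z.im + ‖g w‖ * (4 * w.im / ‖z‖) := by
      refine (norm_sub_le _ _).trans (add_le_add hgz ?_)
      rw [norm_mul]
      exact mul_le_mul_of_nonneg_left hφz (norm_nonneg _)
    rw [hds z hzw, norm_div]
    calc ‖g₁ z‖ / ‖z - w‖ ≤ (C / √z.im + ‖g w‖ * (4 * w.im / ‖z‖)) / (‖z‖ / 2) :=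
          div_le_div₀ (by positivity) hg₁z (by positivity) hzw'
      _ = 2 * C / (√z.im * ‖z‖) + 8 * ‖g w‖ * w.im * (1 / ‖z‖ ^ 2) := by
          field_simp
          ring
      _ ≤ 2 * C / (√z.im * ‖z‖) + 8 * ‖g w‖ * w.im * (1 / (√z.im * ‖z‖)) :=
          add_le_add le_rfl (mul_le_mul_of_nonneg_left
            (inv_norm_sq_le_inv_sqrt_im_mul_norm hz h1)
            (by positivity : (0 : ℝ) ≤ 8 * ‖g w‖ * w.im))
      _ = (2 * C + 8 * ‖g w‖ * w.im) / (√z.im * ‖z‖) := by ring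

end Literature.Analysis.DeBrangesSpaces
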